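import Summits.BirchSwinnertonDyer.Rank1Residual.X4.DepletionRecursion
import HarnessLib

/-!
# Level lowering kills Kurihara numbers mod `p`, part 4h: the depletion recursion preserves SUBRINGS — the source symbol of a principal-series row is ALGEBRAIC ((ALG) of part 4e) as soon as the twisted symbol of `W` is (cell `b2b-bsdres`, seat additive-p4, line V82)

HONEST FRAMING (verbatim, cell `b2b-bsdres`): the goal of the cell is to DELETE the COMBINATION-SHAPED
residual classes for ALL analytic-rank `≤ 1` curves over `ℚ` — "full BSD formula for every rank `≤ 1`
curve in class `C`" assembled STRICTLY from published theorems — so that the rank-`≤ 1` remainder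
becomes exactly the CONSTRUCTION-SHAPED classes, which are TYPED (missing-input Props), NOT attempted;
this is not "finishing BSD". This file: research-route KERNEL THEOREMS (periodic functions over a
commutative ring / a field; no named fact, no conjecture, no definition, nothing booked; class X4 stays
CONSTRUCTION-SHAPED).

## What is proved

Part 4g (`X4/DepletionRecursion`) proved that the recursion `S = λ·S∘[p] + T` has at most one periodic
solution and gave its closed form on `p`-periodic points. This file adds the RATIONALITY consequence
that part 4e (`X4/NebentypusTwistSymbolReduction`) types as the hypothesis (ALG) — "the source symbol is
a period times an `O`-valued function":

* **`depletion_mem_subring`** — if `λ ∈ B`, every `1 − λⁿ` (`n ≥ 1`) has an inverse IN the subring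
  `B ⊆ R`, and `T` is `B`-valued, then the periodic solution `S` is `B`-valued (closed form on a
  `p`-periodic point, then `S(x) = λᵉS(pᵉx) + ∑_{i<e} λⁱT(pⁱx)`).
* **`depletion_div_mem_subfield`** — over a field `𝕜` (e.g. `ℂ`): if a periodic `σ : ℚ → 𝕜` satisfies
  `σ(x) = λ·σ(px) + Ω·T(x)` with `λ` and all `T(x)` in a subfield `F`, no `λⁿ = 1` (`n ≥ 1`), and
  `Ω ≠ 0`, then `σ(x)/Ω ∈ F` for every `x` — i.e. `σ = Ω·s` with `s : ℚ → F`, which is (ALG).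
  READING for a principal-series row (`f_W = g ⊗ χ̄`, `χ` of conductor `p` and order `e`): the
  complex `Γ₁` plus symbol `σ = {∞,·}⁺_g` satisfies the recursion with `λ = a_p(g)/p` and
  `Ω·T = g(χ̄)⁻¹Ω_W⁺·T_{χ̄}[·]⁺_W` (the DEPLETION IDENTITY `f_W ⊗ χ = g − a_p(g)·g(p·)` read at the
  level of symbols — newform theory plus part 4c's linearity; a HYPOTHESIS wherever used), `[·]⁺_W` is
  `ℚ`-valued ((RAT), the tree's `ratCast_ratPlusSymbol`), `χ̄` is `ℚ(ζ_e)`-valued and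
  `|λ| = p^{-1/2}`; so (ALG) holds with `F = ℚ(ζ_e, a_p(g))` and `Ω = g(χ̄)⁻¹Ω_W⁺` — no appeal to
  Shimura 1977 for `Γ₁`. Nothing about any row is proved here; nothing is booked.

## References

* G. Shimura, *Introduction to the arithmetic theory of automorphic functions* (1971), Prop. 3.64.
  [cite: Shimura1971, Prop. 3.64]
* B. Mazur, J. Tate, J. Teitelbaum, Invent. Math. 84 (1986), §I.8. [cite: MazurTateTeitelbaum1986Invent, §I.8]
-/

noncomputable section

open Finset

open Summit.BirchSwinnertonDyer.Rank1Residual.LevelLowering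

namespace Summit.BirchSwinnertonDyer.Rank1Residual.NebentypusTwist

variable {p : ℕ} [hp : Fact p.Prime]

/-! ### §1 The recursion preserves subrings -/

section Subring

variable {R : Type*} [CommRing R] {S T : ℚ → R} {lam : R}

/-- **THE DEPLETION RECURSION PRESERVES SUBRINGS.** If `S` is a periodic solution of
`S(x) = λ·S(px) + T(x)`, `λ ∈ B`, every `1 − λⁿ` (`n ≥ 1`) has an inverse in the subring `B`, and
`T` is `B`-valued, then `S` is `B`-valued. [cite: MazurTateTeitelbaum1986Invent, §I.8] -/
theorem depletion_mem_subring (B : Subring R) (hS : IsPeriodic S)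
    (hrec : ∀ x : ℚ, S x = lam * S (p * x) + T x) (hlamB : lam ∈ B)
    (hinv : ∀ n : ℕ, 0 < n → ∃ v ∈ B, v * (1 - lam ^ n) = 1) (hT : ∀ x : ℚ, T x ∈ B) (x : ℚ) :
    S x ∈ B := by
  obtain ⟨e, n, hn, z, hz⟩ := exists_pow_mul_periodic (p := p) x
  have hsum : ∀ (m : ℕ) (y : ℚ), ∑ i ∈ Finset.range m, lam ^ i * T ((p : ℚ) ^ i * y) ∈ B :=
    fun m y ↦ B.sum_mem fun i _ ↦ B.mul_mem (B.pow_mem hlamB i) (hT _)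
  -- on the periodic point `pᵉ x`
  have hy : S ((p : ℚ) ^ e * x) ∈ B := by
    obtain ⟨v, hvB, hv⟩ := hinv n hn
    have h1 := one_sub_pow_mul_apply_eq_sum hS hrec hz
    have h2 : S ((p : ℚ) ^ e * x) =
        v * ∑ i ∈ Finset.range n, lam ^ i * T ((p : ℚ) ^ i * ((p : ℚ) ^ e * x)) := by
      rw [← h1, ← mul_assoc, hv, one_mul]
    rw [h2]
    exact B.mul_mem hvB (hsum n _)
  rw [eq_pow_mul_add_sum hrec e x]
  exact B.add_mem (B.mul_mem (B.pow_mem hlamB e) hy) (hsum e x)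

end Subring

/-! ### §2 Over a field: the normalised solution lies in the subfield of the data — (ALG) -/

section Subfield

variable {𝕜 : Type*} [Field 𝕜] {σ T : ℚ → 𝕜} {lam Ω : 𝕜}

/-- **(ALG) FROM THE DEPLETION IDENTITY.** Let `F` be a subfield of a field `𝕜`, `σ : ℚ → 𝕜` periodic
with `σ(x) = λ·σ(px) + Ω·T(x)` for all `x`, where `λ ∈ F`, `λⁿ ≠ 1` for all `n ≥ 1`, every `T(x) ∈ F`,
and `Ω ≠ 0`. Then `σ(x)/Ω ∈ F` for every `x`: the normalised solution `s = σ/Ω` solves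
`s = λ·s∘[p] + T` and §1 applies with `B = F`. For the `Γ₁` plus symbol of the source of a
principal-series twist this is hypothesis (ALG) of part 4e with `O ⊆ F = ℚ(ζ_e, a_p(g))`.
[cite: Shimura1971, Prop. 3.64] [cite: MazurTateTeitelbaum1986Invent, §I.8] -/
theorem depletion_div_mem_subfield (F : Subfield 𝕜) (hσ : IsPeriodic σ)
    (hrec : ∀ x : ℚ, σ x = lam * σ (p * x) + Ω * T x) (hlamF : lam ∈ F)
    (hroot : ∀ n : ℕ, 0 < n → lam ^ n ≠ 1) (hT : ∀ x : ℚ, T x ∈ F) (hΩ : Ω ≠ 0) (x : ℚ) :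
    σ x / Ω ∈ F := by
  -- the normalised function solves the recursion with inhomogeneity `T`
  have hper : IsPeriodic (fun x ↦ σ x / Ω) := fun r z ↦ by
    show σ (r + z) / Ω = σ r / Ω
    rw [hσ r z]
  have hrec' : ∀ x : ℚ, σ x / Ω = lam * (σ (p * x) / Ω) + T x := by
    intro x
    rw [hrec x]
    field_simp
  have hinv : ∀ n : ℕ, 0 < n → ∃ v ∈ F.toSubring, v * (1 - lam ^ n) = 1 := by
    intro n hn
    have hne : (1 : 𝕜) - lam ^ n ≠ 0 := sub_ne_zero.mpr (hroot n hn).symm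
    exact ⟨(1 - lam ^ n)⁻¹, F.inv_mem (F.sub_mem F.one_mem (F.pow_mem hlamF n)),
      inv_mul_cancel₀ hne⟩
  exact depletion_mem_subring (p := p) F.toSubring hper hrec' hlamF hinv hT x

/-- **(ALG) as an existence statement**: under the same hypotheses there is `s : ℚ → F` with
`σ(x) = Ω·s(x)` for all `x`, and `s` is periodic and solves `s = λ·s∘[p] + T` in `F`.
[cite: Shimura1971, Prop. 3.64] [cite: MazurTateTeitelbaum1986Invent, §I.8] -/
theorem exists_subfield_valued_of_depletion (F : Subfield 𝕜) (hσ : IsPeriodic σ)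
    (hrec : ∀ x : ℚ, σ x = lam * σ (p * x) + Ω * T x) (hlamF : lam ∈ F)
    (hroot : ∀ n : ℕ, 0 < n → lam ^ n ≠ 1) (hT : ∀ x : ℚ, T x ∈ F) (hΩ : Ω ≠ 0) :
    ∃ s : ℚ → F, (∀ x : ℚ, σ x = Ω * (s x : 𝕜)) ∧ IsPeriodic s ∧
      ∀ x : ℚ, (s x : 𝕜) = lam * (s (p * x) : 𝕜) + T x := by
  refine ⟨fun x ↦ ⟨σ x / Ω, depletion_div_mem_subfield (p := p) F hσ hrec hlamF hroot hT hΩ x⟩,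
    fun x ↦ ?_, fun r z ↦ ?_, fun x ↦ ?_⟩
  · show σ x = Ω * (σ x / Ω)
    field_simp
  · exact Subtype.ext (by show σ (r + z) / Ω = σ r / Ω; rw [hσ r z])
  · show σ x / Ω = lam * (σ (p * x) / Ω) + T x
    rw [hrec x]
    field_simp

end Subfield

end Summit.BirchSwinnertonDyer.Rank1Residual.NebentypusTwist

end
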